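/-
Copyright (c) 2026. All rights reserved.
Released under Apache 2.0 license as described in the file LICENSE.
Authors: abc-iut cell, campaign-S prover seat abc-iut-S1 (wave 1).
-/
import Mathlib.RingTheory.PiTensorProduct
import Mathlib.RingTheory.IntegralClosure.IsIntegralClosure.Basic
import Literature.IUT.LogVolume.LocalUnitLog
import Literature.IUT.LogVolume.RamificationInvariants
import Literature.IUT.LogVolume.IntegerRing
import HarnessLib

/-!
# The tensor packet ring `R_I = ⊗_{ℤ_p} R_i` and its normalisation; [IUTchIV] Prop. 1.1, 1.2 (ii)–(iv)

Mochizuki, *Inter-universal Teichmüller theory IV*, RIMS manuscript (Apr. 2020), §1, kurims pp. 9–11: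
Proposition 1.1 "(Multiple Tensor Products and Differents)" and Proposition 1.2 "(Differents and
Logarithms)", parts (ii)–(iv).  TYPED STATEMENTS (named `Prop`s) over real definitions; the proofs are
separate files of the cell (statements first, D-0055).  Part (i) of Prop. 1.2 is PROVED in
`LogRadius.lean`.

**Prop. 1.1 as printed (p. 9).** "Let `p` be a prime number, `I` a finite set of cardinality `≥ 2`,
`ℚ̄_p` an algebraic closure of `ℚ_p`. … For `i ∈ I`, let `k_i ⊆ ℚ̄_p` be a finite extension of `ℚ_p`;
write `R_i := 𝒪_{k_i}` … and `d_i ∈ ℚ_{≥0}` for the order of any generator of the different ideal of `R_i`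
over `ℤ_p`. Also, for any nonempty subset `E ⊆ I`, let us write `R_E := ⊗_{i∈E} R_i`; `d_E := Σ_{i∈E} d_i`
— where the tensor product is over `ℤ_p`. Fix an element `* ∈ I`; write `I* := I ∖ {*}`. Then
`p^{d_{I*}}·(R_I)^∼ ⊆ R_I ⊆ (R_I)^∼` — where we write `(−)^∼` for the normalization of the [reduced]
ring in parentheses in its ring of fractions, and … the notation on the left-hand side … is
well-defined for suitable `p^{d_{I*}}` [such as products of elements `p^{d_i} ∈ R_i`, for `i ∈ I*`] and
independent of the choice of such suitable `p^{d_{I*}}`."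

**Prop. 1.2 (ii)–(iv) as printed (pp. 10–11).** With `log_p(R_E^×) := ⊗_{i∈E} log_p(R_i^×)`,
`a_E := Σ a_i`, `b_E := Σ b_i` (tensor product over `ℤ_p`), and
`φ : log_p(R_I^×) ⊗ ℚ_p ⥲ log_p(R_I^×) ⊗ ℚ_p` an automorphism of the finite dimensional `ℚ_p`-vector
space that induces an automorphism of the submodule `log_p(R_I^×)`:
"(ii) `φ(p^λ·(R_I)^∼) ⊆ p^{⌊λ−d_I−a_I⌋}·log_p(R_I^×) ⊆ p^{⌊λ−d_I−a_I⌋−b_I}·(R_I)^∼` for any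
`λ ∈ (1/e_i)·ℤ`, `i ∈ I`. In particular, `φ((R_I)^∼) ⊆ p^{−⌈d_I+a_I⌉}·log_p(R_I^×) ⊆
p^{−⌈d_I+a_I⌉−b_I}·(R_I)^∼`.  (iii) Suppose that `p > 2`, and that `e_i ≤ p−2` for all `i ∈ I`. Then
`φ(p^λ·(R_I)^∼) ⊆ p^{λ−d_I−1}·(R_I)^∼` for any `λ ∈ (1/e_i)·ℤ`, `i ∈ I`. In particular,
`φ((R_I)^∼) ⊆ p^{−d_I−1}·(R_I)^∼`.  (iv) If `p > 2` and `e_i = 1` for all `i ∈ I`, then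
`φ((R_I)^∼) ⊆ (R_I)^∼`."

## Modelling (read with the referee)

* The `k_i` are a finite family `k : I → Type` of fields in the norm-side MLF setting of the cell (every
  finite `k_i ⊆ ℚ̄_p` is one).  All objects are realised INSIDE the `ℚ_p`-algebra
  `V := ⊗_{ℚ_p, i∈I} k_i` (`PacketAlgebra`, Mathlib `PiTensorProduct`), which is at the same time
  `R_I ⊗ ℚ_p`, the ring of fractions of the reduced ring `R_I` (a finite product of fields), and
  `log_p(R_I^×) ⊗ ℚ_p` (each `log_p(R_i^×)` is a full `ℤ_p`-lattice of `k_i`, `LogRadius.lean`): since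
  `R_i` and `log_p(R_i^×)` are free `ℤ_p`-modules, `⊗_{ℤ_p} R_i → V` and `⊗_{ℤ_p} log_p(R_i^×) → V` are
  injective, and their images are the additive subgroups generated by the pure tensors — this is how
  `integerPacket` (`R_I`) and `logPacket` (`log_p(R_I^×)`) are DEFINED here; `(R_I)^∼` is the integral
  closure of `R_I` in `V` (`normalizedPacket`).  The identifications just listed are theorems owed by the
  proofs file, not used in the statements.
* "`p^μ · M`" for a fractional exponent is, as in the text, multiplication by a suitable product of
  elements `g_i ∈ k_i` with `ord(g_i) = μ_i`, `Σ μ_i = μ` (through `ι_i : k_i → V`); the statements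
  quantify over ALL such choices (the text asserts independence of the choice).  Sub-packets `E ⊆ I`
  are the same constructions on the subtype and are not separately named.

* The standing hypothesis of Prop. 1.1, "`I` a finite set of cardinality `≥ 2`", which Prop. 1.2 keeps
  ("We continue to use the notation of Proposition 1.1"), is the first hypothesis `2 ≤ Fintype.card I`
  of EVERY statement below (for `I = ∅` the "In particular" clause of (ii) would be false as typed:
  `V = ℚ_p`, `(R_I)^∼ ⊋ ℤ·1`; observed by abc-iut-S5).

Deliberately NOT here: any proof; log-volumes (Prop. 1.4, abc-iut-S2); the cases `|I| ≤ 1`.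
-/

noncomputable section

open Metric Set
open scoped Pointwise TensorProduct NormedField

namespace Literature.IUT.LogVolume

variable (p : ℕ) [Fact p.Prime]
variable {I : Type} [Fintype I] [DecidableEq I]
variable (k : I → Type) [∀ i, NontriviallyNormedField (k i)] [∀ i, NormedAlgebra ℚ_[p] (k i)]

/-! ## The ambient algebra `V = ⊗_{ℚ_p} k_i` and the packet rings -/

/-- **`V := ⊗_{ℚ_p, i ∈ I} k_i`** — the finite-dimensional commutative `ℚ_p`-algebra that [IUTchIV]
Prop. 1.2 calls "`log_p(R_I^×) ⊗ ℚ_p`" (= `R_I ⊗_{ℤ_p} ℚ_p`, the ring of fractions of `R_I`).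
[claim: Mochizuki2012, status: disputed] -/
abbrev PacketAlgebra : Type := ⨂[ℚ_[p]] i, k i

/-- The `i`-th coprojection `ι_i : k_i → V`, `a ↦ 1 ⊗ ⋯ ⊗ a ⊗ ⋯ ⊗ 1` (Mathlib `singleAlgHom`).
[claim: Mochizuki2012, status: disputed] -/
def iota (i : I) : k i →ₐ[ℚ_[p]] PacketAlgebra p k := PiTensorProduct.singleAlgHom i

/-- The pure tensor `⊗_i x_i ∈ V` of a family `x ∈ Π_i k_i`. [claim: Mochizuki2012, status: disputed] -/
def purePacket (x : Π i, k i) : PacketAlgebra p k := PiTensorProduct.tprod ℚ_[p] x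

/-- **`R_I := ⊗_{ℤ_p, i∈I} R_i`** ([IUTchIV] Prop. 1.1, p. 9), realised as the subring of `V` generated by
the pure tensors of integers `⊗ x_i`, `‖x_i‖ ≤ 1` (= the image of the injective map
`⊗_{ℤ_p} R_i → V`, see the modelling note). [claim: Mochizuki2012, status: disputed] -/
def integerPacket : Subring (PacketAlgebra p k) :=
  Subring.closure {t | ∃ x : Π i, k i, (∀ i, ‖x i‖ ≤ 1) ∧ t = purePacket p k x}

/-- **`(R_I)^∼`**, "the normalization of the [reduced] ring `R_I` in its ring of fractions" ([IUTchIV]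
Prop. 1.1, p. 9): the integral closure of `R_I` in `V = R_I ⊗ ℚ_p`, as a subring of `V`.
[claim: Mochizuki2012, status: disputed] -/
def normalizedPacket : Subring (PacketAlgebra p k) :=
  (integralClosure (integerPacket p k) (PacketAlgebra p k)).toSubring

/-- **`log_p(R_I^×) := ⊗_{ℤ_p, i∈I} log_p(R_i^×)`** ([IUTchIV] Prop. 1.2, p. 10), realised as the additive
subgroup of `V` generated by the pure tensors `⊗ z_i`, `z_i ∈ log_p(R_i^×)` (`logUnits`, `LocalUnitLog.lean`).
[claim: Mochizuki2012, status: disputed] -/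
def logPacket : AddSubgroup (PacketAlgebra p k) :=
  AddSubgroup.closure {t | ∃ z : Π i, k i, (∀ i, z i ∈ logUnits (k i)) ∧ t = purePacket p k z}

/-- Integer powers of `p` in `V`: `p^n := algebraMap ℚ_p V (p^n)`, `n ∈ ℤ` (`V` is not a field, so
`zpow` is taken in `ℚ_p`). [claim: Mochizuki2012, status: disputed] -/
def ppow (n : ℤ) : PacketAlgebra p k := algebraMap ℚ_[p] (PacketAlgebra p k) ((p : ℚ_[p]) ^ n)

/-! ## The invariants `d_I`, `a_I`, `b_I` -/

section Invariants

variable [∀ i, IsUltrametricDist (k i)] [∀ i, ProperSpace (k i)]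

/-- `d_I := Σ_{i∈I} d_i` ([IUTchIV] Prop. 1.1, p. 9). [claim: Mochizuki2012, status: disputed] -/
def dSum : ℝ := ∑ i, differentOrd p (k i)

/-- `a_I := Σ_{i∈I} a_i` ([IUTchIV] Prop. 1.2, p. 10). [claim: Mochizuki2012, status: disputed] -/
def aSum : ℝ := ∑ i, logRadiusA p (absRamificationIdx p (k i))

/-- `b_I := Σ_{i∈I} b_i` ([IUTchIV] Prop. 1.2, p. 10). [claim: Mochizuki2012, status: disputed] -/
def bSum : ℝ := ∑ i, logRadiusB p (absRamificationIdx p (k i))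

end Invariants

/-! ## Proposition 1.1 -/

section Prop11

variable [∀ i, IsUltrametricDist (k i)] [∀ i, ProperSpace (k i)]

/-- **[IUTchIV] Proposition 1.1** (p. 9): `|I| ≥ 2`; for `* ∈ I` and any choice of generators `δ_i` of
the different ideals of `R_i` (`i ∈ I* = I ∖ {*}`; so `⊗_{i∈I*} δ_i ⊗ 1` is a "suitable `p^{d_{I*}}`"):
`p^{d_{I*}}·(R_I)^∼ ⊆ R_I ⊆ (R_I)^∼`. [claim: Mochizuki2012, status: disputed] -/
def Prop11 : Prop :=
  2 ≤ Fintype.card I →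
    ∀ (star : I) (δ : Π i, Valued.integer (k i)),
      (∀ i, i ≠ star → different p (k i) = Ideal.span {δ i}) → δ star = 1 →
        (∀ x ∈ normalizedPacket p k,
            purePacket p k (fun i ↦ (δ i : k i)) * x ∈ integerPacket p k) ∧
          integerPacket p k ≤ normalizedPacket p k

end Prop11

/-! ## Proposition 1.2 (ii)–(iv) -/

section Prop12

variable [∀ i, IsUltrametricDist (k i)] [∀ i, ProperSpace (k i)]

/-- `φ` "an automorphism of the finite dimensional `ℚ_p`-vector space `log_p(R_I^×) ⊗ ℚ_p` that induces an
automorphism of the submodule `log_p(R_I^×)`" ([IUTchIV] Prop. 1.2, p. 10): a `ℚ_p`-linear automorphism of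
`V` mapping `log_p(R_I^×)` onto itself. [claim: Mochizuki2012, status: disputed] -/
def IsLogPacketAut (φ : PacketAlgebra p k ≃ₗ[ℚ_[p]] PacketAlgebra p k) : Prop :=
  φ '' (logPacket p k : Set (PacketAlgebra p k)) = logPacket p k

/-- A family `h ∈ Π_i k_i` **realises the exponent `−b_I`**: `ord(h_i) = −b_i`, i.e. `‖h_i‖ = p^{b_i}`
(so `⊗ h_i` is a "`p^{−b_I}`"; such `h` exist since `b_i ∈ (1/e_i)ℤ`). [claim: Mochizuki2012, status: disputed] -/
def RealizesNegB (h : Π i, k i) : Prop :=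
  ∀ i, ‖h i‖ = (p : ℝ) ^ logRadiusB p (absRamificationIdx p (k i))

/-- **[IUTchIV] Proposition 1.2 (ii)** (p. 10): for `i ∈ I`, `λ = m/e_i ∈ (1/e_i)ℤ`, an element
`g ∈ k_i` with `ord(g) = λ`, `n := ⌊λ − d_I − a_I⌋`, and any realisation `h` of `p^{−b_I}`:
`φ(p^λ·(R_I)^∼) ⊆ p^{n}·log_p(R_I^×) ⊆ p^{n−b_I}·(R_I)^∼`. [claim: Mochizuki2012, status: disputed] -/
def Prop12ii : Prop :=
  2 ≤ Fintype.card I →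
  ∀ (φ : PacketAlgebra p k ≃ₗ[ℚ_[p]] PacketAlgebra p k), IsLogPacketAut p k φ →
    ∀ (i : I) (m : ℤ) (g : k i),
      ‖g‖ = (p : ℝ) ^ (-((m : ℝ) / absRamificationIdx p (k i))) →
      ∀ (h : Π i, k i), RealizesNegB p k h →
        letI n : ℤ := ⌊(m : ℝ) / absRamificationIdx p (k i) - dSum p k - aSum p k⌋
        φ '' (iota p k i g • (normalizedPacket p k : Set (PacketAlgebra p k))) ⊆
            ppow p k n • (logPacket p k : Set (PacketAlgebra p k)) ∧
          ppow p k n • (logPacket p k : Set (PacketAlgebra p k)) ⊆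
            (ppow p k n * purePacket p k h) • (normalizedPacket p k : Set (PacketAlgebra p k))

/-- **[IUTchIV] Proposition 1.2 (ii), "In particular"** (p. 10): with `N := ⌈d_I + a_I⌉`,
`φ((R_I)^∼) ⊆ p^{−N}·log_p(R_I^×) ⊆ p^{−N−b_I}·(R_I)^∼`. [claim: Mochizuki2012, status: disputed] -/
def Prop12ii' : Prop :=
  2 ≤ Fintype.card I →
  ∀ (φ : PacketAlgebra p k ≃ₗ[ℚ_[p]] PacketAlgebra p k), IsLogPacketAut p k φ →
    ∀ (h : Π i, k i), RealizesNegB p k h →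
      letI N : ℤ := ⌈dSum p k + aSum p k⌉
      φ '' (normalizedPacket p k : Set (PacketAlgebra p k)) ⊆
          ppow p k (-N) • (logPacket p k : Set (PacketAlgebra p k)) ∧
        ppow p k (-N) • (logPacket p k : Set (PacketAlgebra p k)) ⊆
          (ppow p k (-N) * purePacket p k h) • (normalizedPacket p k : Set (PacketAlgebra p k))

/-- **[IUTchIV] Proposition 1.2 (iii)** (p. 11): `p > 2` and `e_i ≤ p − 2` for all `i`; for `i ∈ I`,
`λ = m/e_i`, `g ∈ k_i` with `ord(g) = λ`, and generators `δ_j` of the differents (`ord(⊗δ_j) = d_I`):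
`φ(p^λ·(R_I)^∼) ⊆ p^{λ−d_I−1}·(R_I)^∼`, the element `p^{λ−d_I−1}` being realised as
`ι_i(g)·(⊗_j δ_j⁻¹)·p⁻¹` (inverses taken in the fields `k_j`, `ℚ_p`). [claim: Mochizuki2012, status: disputed] -/
def Prop12iii : Prop :=
  2 ≤ Fintype.card I → 2 < p → (∀ i, absRamificationIdx p (k i) ≤ p - 2) →
    ∀ (φ : PacketAlgebra p k ≃ₗ[ℚ_[p]] PacketAlgebra p k), IsLogPacketAut p k φ →
      ∀ (i : I) (m : ℤ) (g : k i),
        ‖g‖ = (p : ℝ) ^ (-((m : ℝ) / absRamificationIdx p (k i))) →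
        ∀ (δ : Π j, Valued.integer (k j)), (∀ j, different p (k j) = Ideal.span {δ j}) →
          φ '' (iota p k i g • (normalizedPacket p k : Set (PacketAlgebra p k))) ⊆
            (iota p k i g * purePacket p k (fun j ↦ ((δ j : k j))⁻¹) * ppow p k (-1)) •
              (normalizedPacket p k : Set (PacketAlgebra p k))

/-- **[IUTchIV] Proposition 1.2 (iii), "In particular"** (p. 11): under the same hypotheses,
`φ((R_I)^∼) ⊆ p^{−d_I−1}·(R_I)^∼`. [claim: Mochizuki2012, status: disputed] -/
def Prop12iii' : Prop :=
  2 ≤ Fintype.card I → 2 < p → (∀ i, absRamificationIdx p (k i) ≤ p - 2) →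
    ∀ (φ : PacketAlgebra p k ≃ₗ[ℚ_[p]] PacketAlgebra p k), IsLogPacketAut p k φ →
      ∀ (δ : Π j, Valued.integer (k j)), (∀ j, different p (k j) = Ideal.span {δ j}) →
        φ '' (normalizedPacket p k : Set (PacketAlgebra p k)) ⊆
          (purePacket p k (fun j ↦ ((δ j : k j))⁻¹) * ppow p k (-1)) •
            (normalizedPacket p k : Set (PacketAlgebra p k))

/-- **[IUTchIV] Proposition 1.2 (iv)** (p. 11): if `p > 2` and `e_i = 1` for all `i ∈ I`, then
`φ((R_I)^∼) ⊆ (R_I)^∼`. [claim: Mochizuki2012, status: disputed] -/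
def Prop12iv : Prop :=
  2 ≤ Fintype.card I → 2 < p → (∀ i, absRamificationIdx p (k i) = 1) →
    ∀ (φ : PacketAlgebra p k ≃ₗ[ℚ_[p]] PacketAlgebra p k), IsLogPacketAut p k φ →
      φ '' (normalizedPacket p k : Set (PacketAlgebra p k)) ⊆ normalizedPacket p k

end Prop12

end Literature.IUT.LogVolume

end
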